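import Literature.MathematicalPhysics.QuantumFieldTheory.Balaban1983to89.B9Thm313WholeDvHolderAtPins
import Literature.MathematicalPhysics.QuantumFieldTheory.Balaban1983to89.B9GradViaDivLettersSmooth
import Literature.MathematicalPhysics.QuantumFieldTheory.Balaban1983to89.B9MultiscaleSmoothPartitionYNear

/-!
# `Balaban1983to89.B9Thm313WholeDvHolderAtPinsSmooth` — THE FOUR D_U-ORBIT HÖLDER MEMBERS OF ROWS 20–21 RE-PINNED AT THE SMOOTH-PARTITION CLASSES:
# `h44DsDv` (D\*G₀D_U), `dgDHd` (∇_{U,ν}G₀D_U), `dgDH` (∇_UG₀D_U), `pYDH` (Φ^Y_β∇_UG₀D_U) with source `bH13 := weightNorm (bHZ 1 p) (Lʲη)⁻¹` (resp. `bHZ ε p`) and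
# input class `bHZK` for the displayed (3.44)∕(3.45) members — the twins of `B9Thm313WholeDvHolderAtPins` (p622451) with n06-l g20's smooth J-letter in place of the sharp one

T. Bałaban, *Propagators for lattice gauge theories in a background field*, Commun. Math. Phys. **99** (1985) 389–434
[`Balaban1985BackgroundPropagators`, "B9"]; [4] = T. Bałaban, *Propagators and renormalization transformations for lattice gauge
theories. II*, Commun. Math. Phys. **96** (1984) 223–250 [`Balaban1984PropagatorsII`].

statement-level skeleton of published theorems with citation tags; proofs where landed; nothing here is a claim about the
Yang–Mills mass gap

THE PRINTED LOCI.  [B9] Thm 3.3 (3.44)–(3.45) p. 398 + the remark after (3.47) (*"λ replaced by a function J defined at bonds"*); Thm 3.13 p. 426 with (3.152)–(3.153);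
(3.3) p. 390; (3.35) p. 396; [4] (2.51)–(2.56) pp. 232–233, Lemma 2.1 (2.60)–(2.61) p. 234.

WHY THIS FILE (cell `pub-ymgap`, node N06, seat dag-n06-l g20; ninth piece of the (F1) programme; resume trigger (t4) of HOME HANDOFF §g20).  p622451 pinned the four members at
`bH13 := weightNorm (bHS (sIK bI) 1) (Lʲη)⁻¹` — a SHARP-cut class in which no producer of `bH13` exists («SHARP-CUT JUMPS»).  With the smooth classes (`bHZ`, `bHZK`) and the smooth
J-letter (`B9GradViaDivLettersSmooth.hasMaj_JcoKH_smooth`, radius discharged by n06-w6's `dist_sIK_le_of_nearY`) the SAME class-generic schema algebra of `B9Thm313WholeDvHolderFromDds` re-pins them at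
`bH13 := weightNorm (bHZ i 1 p) (Lʲη)⁻¹` (`p ≥ 1`), the (3.44)∕(3.45) members being DISPLAYED at the smooth bond class `bHZK i 1 p` (print's input class «supp λ ⊂ Δ̃(y′), (‖λ‖₁ + |λ|)»;
honest at the smooth class — n06-w6 g3 LOCATED-IRF: the input FAMILIES stay sharp, only the free intermediates move):
* `hasMaj_JcoKH_smooth_len` — the smooth J-letter from the `(Lʲη)⁻¹`-weighted source (`hasMaj_weight_source_inv_len`);
* ★★ `h44DsDv_pins_smooth`, ★★ `dgDHd_pins_smooth`, ★★ `dgDH_pins_smooth`, ★★ `pYDH_pins_smooth` — for SU(N)-valued links (`hUG`, background-generic `(B, rd)` = the CASCADE-R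
  `_of_mem` currency), the certificate's `hβ1 ∕ hbI0`, the kinematic pins `hDv ∕ hDds ∕ hD ∕ hDd ∕ hblk ∕ hblkY`, the member facts `GeoOK ∕ RowSum ∕ Facts347`, the ξ-scale small-gauge
  binder `hΘ` (displayed) and the displayed (3.44)∕(3.45) members at `bHZK`; NO `κ` binder (κ = 1 + C_Lip by `bHZK_κ`), NO radius binder (LAYER B).
HONEST SCOPE.  By-name compositions of landed class-generic engines with the landed smooth letter; the (3.44)∕(3.45) members, `hΘ`, `RowSum`, `Facts347` are HYPOTHESES;
nothing of [B9]∕[4] asserted; no certificate edit (a pin `bH13 := weightNorm (bHZ …) (Lʲη)⁻¹` is the knit's); COUNT-NEUTRAL; N06 NOT discharged; nothing continuum, nothing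
about the mass gap.  Cell `pub-ymgap` (HUMAN RULING D-0062), Track A node N06 [B9], seat `pub-ymgap-dag-n06-l` (g20), 2026-08-28.
-/

noncomputable section

namespace Literature.MathematicalPhysics.QuantumFieldTheory.Balaban1983to89.B9Thm313WholeDvHolderAtPinsSmooth

open scoped Matrix.Norms.L2Operator
open Node00 B6GlobalChartV1 B6KLevelCensusIndexV1
open B6Geom246MultiLevelTorus (geomT)
open B6Ineq2142KLevelV1 (β)
open B11SectG (HasMaj RowSum BlockNorm)
open B9Thm34Ext (toB6)
open B9SectDSup (weightNorm)
open B9Thm312Whole (cNorm GeoOK Ops)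
open B9Thm312WholeClasses (cNormR)
open B9RWSums343to347Whole (Facts347)
open B9Thm39ReadingCoords (cR39 cR39_nonneg)
open B9CoReadingCoords (XBK coordOpK cdBₗ cdsBₗ blkBK)
open B9CoReadingCoordsS (XSK blkSK sIK)
open B7Prop2SpecialUnitary (specialUnitaryUnits specialUnitaryUnits_le_U1)
open Node00.OpsYSectDCoords (DvcoKH)
open B9GeoNormsKLevelV1 (geo9K)
open B9GradViaDivLettersAtPins (JcoKH rJ sliceProjK DvcoKH_eq_sum DcoK_eq_sum)
open B9GradViaDivLettersAtPinsHolderPairs (hasMaj_weight_source_inv_len)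
open B9Thm313WholeDvHolderFromDds (h44DsDv_of_h44Ds dgDHd_of_h44m dgDH_of_h44m pYDH_of_h45Y)
open B9Thm313WholeDvHolderAtPins (hasMaj_sliceProjK_cNorm)
open B9RWSums343Holder (HolderProbes)
open B9MultiscaleSmoothPartitionYNear (rNear dist_sIK_le_of_nearY)
open B9MultiscaleSmoothPartitionYLip (CLip CLip_nonneg)
open B9SmoothHolderClassS (bHZ)
open B9SmoothHolderClassK (bHZK)
open B9GradViaDivLettersSmoothTerms (CJZ rZ)
open B9GradViaDivLettersSmooth (hasMaj_JcoKH_smooth)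

variable {d ℓ : ℕ} {hd : 1 ≤ d + 1} {hL : Odd (ℓ + 1) ∧ 1 < ℓ + 1} {b₀ b₁ : ℝ}
variable (i : KIdx d ℓ hd hL b₀ b₁) [Fintype (geo9K i).Site] {κ : Type} [Fintype κ]

/-! ## §0 The constant and the length-weighted smooth J-letter -/

/-- the smooth J-letter constant at the discharged radius: `cR39·CJZ ℓ p ϑ·e^{δ·rZ d ℓ (rNear + 1)}`. OURS. [cite: Balaban1985BackgroundPropagators, (3.3) p.390 + p.398 (remark after (3.47)), dictionary] -/
def CJS {𝔸 : Type} [NormedRing 𝔸] [NormedAlgebra ℂ 𝔸] [FiniteDimensional ℝ 𝔸] (b : Module.Basis κ ℝ 𝔸) (p ϑ δ : ℝ) : ℝ :=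
  cR39 b * CJZ ℓ p ϑ * Real.exp (δ * rZ d ℓ (rNear d ℓ + 1))

omit [Fintype (geo9K i).Site] in
/-- `0 ≤ CJS` for `ϑ ≥ 0`. [cite: Balaban1985BackgroundPropagators, (3.48) p.398, bookkeeping] -/
theorem CJS_nonneg {𝔸 : Type} [NormedRing 𝔸] [NormedAlgebra ℂ 𝔸] [FiniteDimensional ℝ 𝔸] (b : Module.Basis κ ℝ 𝔸) {p ϑ : ℝ} (hϑ : 0 ≤ ϑ) (δ : ℝ) :
    0 ≤ CJS (d := d) (ℓ := ℓ) b p ϑ δ := by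
  have := cR39_nonneg b
  have : 0 ≤ CJZ ℓ p ϑ := by unfold CJZ; positivity
  unfold CJS; positivity

section Weighted

variable {𝔸 : Type} [NormedRing 𝔸] [NormedAlgebra ℂ 𝔸] [CompleteSpace 𝔸]
variable (b : Module.Basis κ ℝ 𝔸) [FiniteDimensional ℝ 𝔸] (B : B9.Backgrounds) (cfg : B.Cfg → CfgY 𝔸 i)
variable {bI : FBondY i → IBondY i}

/-- **THE SMOOTH J-LETTER FROM THE `(Lʲη)⁻¹`-WEIGHTED SOURCE** (`bH13 := weightNorm (bHZ ε p) (Lʲη)⁻¹`): kernel `CJS·L·(Lʲη)(a)·e^{−(δ−αδ_F)d}` under the member facts ([4] (2.60)).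
[cite: Balaban1985BackgroundPropagators, (3.3) p.390 + p.398 (remark after (3.47)); Balaban1984PropagatorsII, Lemma 2.1 (2.60) p.234] -/
theorem hasMaj_JcoKH_smooth_len (hG : GeoOK (geo9K i)) {R₀ : ℝ} {H₀ : Prop} {dF : ℕ} {δ' α L₀ : ℝ} (hF : Facts347 (geo9K i) R₀ H₀ dF δ' α L₀)
    {ε p : ℝ} (hε0 : 0 ≤ ε) (hε1 : ε ≤ 1) (hεp : ε ≤ p)
    (hβ1 : ∀ f : FBondY i, (geomT i.D).dist (β i.hN i.D i.hk (bI f)) (blkV1 i.hN i.D f) ≤ 1)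
    (hbI0 : ∀ f : FBondY i, bI f = bI ⟨f.src, 0⟩) {U₁ : B.Cfg}
    (hU : ∀ (ν : Fin (d + 1)) (s : Site (PV d ℓ i.m i.K hd hL) 0), ‖(cfg U₁ ν s : 𝔸)‖ ≤ 1 ∧ ‖(((cfg U₁ ν s)⁻¹ : 𝔸ˣ) : 𝔸)‖ ≤ 1)
    {ϑ : ℝ} (hϑ : 0 ≤ ϑ)
    (hΘ : ∀ (μ : Fin (d + 1)) (s s' : Site (PV d ℓ i.m i.K hd hL) 0), Adm i ⟨s, μ⟩ ⟨s', μ⟩ →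
      tpar i ⟨s, μ⟩ ⟨s', μ⟩ ^ (-ε) * ‖(cfg U₁ μ s : 𝔸) - (cfg U₁ μ s' : 𝔸)‖ ≤ ϑ)
    {δ : ℝ} (hδ : 0 ≤ δ) (μ : Fin (d + 1)) :
    HasMaj (weightNorm (bHZ (κ := κ) i (R := R₀) (H := H₀) hε0 hε1 hεp) (fun y => ((geo9K i).len y)⁻¹) fun y => inv_nonneg.2 (hG.lenle y))
      (bHZK (κ := κ) i (R := R₀) (H := H₀) hε0 hε1 hεp) (JcoKH i b B cfg μ U₁)
      (fun a a' => CJS (d := d) (ℓ := ℓ) b p ϑ δ * (geo9K i).L * (geo9K i).len a * Real.exp (-((δ - α * δ') * (geo9K i).dist a a'))) :=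
  hasMaj_weight_source_inv_len hG hF (CJS_nonneg (d := d) (ℓ := ℓ) b hϑ δ)
    (hasMaj_JcoKH_smooth i b B cfg hε0 hε1 hεp hβ1 hbI0 hU hϑ hΘ (fun _ _ h => dist_sIK_le_of_nearY i hβ1 h) hδ μ)

end Weighted

/-! ## §1 The four members at the smooth pin, SU(N) links (`_of_mem`, background-generic) -/

section Members

variable {N : ℕ} [NeZero N] (B : B9.Backgrounds) (rd : B.Cfg → CfgY (Matrix (Fin N) (Fin N) ℂ) i) (b : Module.Basis κ ℝ (Matrix (Fin N) (Fin N) ℂ))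
variable {bI : FBondY i → IBondY i}

/-- ★★ **`Thm33G0DivR.h44DsDv ε` AT THE SMOOTH PIN** — D\*G₀D_U : `bHZ ε p → 𝔠_W⁽⁰⁾` from the displayed directional (3.44) members `h44Ds μ` at the input class `bHZK ε p` and the smooth
J-letter; `B_dD ≥ (d+1)·(1 + C_Lip)·B_iD·CJS·c`, `0 ≤ δ₃ ≤ δ₀`, `δ₃ + σ ≤ δ_J`. [cite: Balaban1985BackgroundPropagators, Thm 3.3 (3.44) p.398 + (3.3) p.390 + (3.35) p.396 + p.398 (remarks after (3.47)); Balaban1984PropagatorsII, (2.26) p.228 + (2.52)–(2.56) pp.232–233 + Lemma 2.1 (2.61) p.234] -/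
theorem h44DsDv_pins_smooth {R₀ : ℝ} {H₀ : Prop} {ε p : ℝ} (hε0 : 0 ≤ ε) (hε1 : ε ≤ 1) (hεp : ε ≤ p)
    (hβ1 : ∀ f : FBondY i, (geomT i.D).dist (β i.hN i.D i.hk (bI f)) (blkV1 i.hN i.D f) ≤ 1)
    (hbI0 : ∀ f : FBondY i, bI f = bI ⟨f.src, 0⟩) {U : B.Cfg}
    (hUG : ∀ (ν : Fin (d + 1)) (s : Site (PV d ℓ i.m i.K hd hL) 0), rd U ν s ∈ specialUnitaryUnits (Fin N)) {ϑ : ℝ} (hϑ : 0 ≤ ϑ)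
    (hΘ : ∀ (μ : Fin (d + 1)) (s s' : Site (PV d ℓ i.m i.K hd hL) 0), Adm i ⟨s, μ⟩ ⟨s', μ⟩ →
      tpar i ⟨s, μ⟩ ⟨s', μ⟩ ^ (-ε) * ‖(rd U μ s : Matrix (Fin N) (Fin N) ℂ) - (rd U μ s' : Matrix (Fin N) (Fin N) ℂ)‖ ≤ ϑ)
    (hG : GeoOK (geo9K i)) {σ c : ℝ} (hrow : RowSum (toB6 (geo9K i) R₀ H₀) σ c) {Y : Type} [Fintype Y] {W : Type} [Fintype W]
    (𝔬 : Ops (geo9K i) B (XBK κ i) Y W (XSK κ i))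
    (hDv : 𝔬.Dv U = DvcoKH i b B rd U)
    {Dds : Fin (d + 1) → Module.End ℝ (XBK κ i → ℝ)} (hDds : Dds = fun μ => coordOpK b (fun _ : Fin (d + 1) => cdsBₗ i (rd U) μ))
    {BiD δ₀ δJ BdD δ₃ : ℝ} (hBiD : 0 ≤ BiD) (hδJ : 0 ≤ δJ) (hδ₃ : 0 ≤ δ₃) (hδ₃0 : δ₃ ≤ δ₀) (hδ₃J : δ₃ + σ ≤ δJ)
    (hBdD : ((d : ℝ) + 1) * ((1 + CLip d ℓ) * BiD * CJS (d := d) (ℓ := ℓ) b p ϑ δJ * c) ≤ BdD)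
    (h44Ds : ∀ μ, HasMaj (bHZK (κ := κ) i (R := R₀) (H := H₀) hε0 hε1 hεp) (cNormR R₀ H₀ 𝔬.blkW hG.lenle 0) (𝔬.Dvstar U ∘ₗ (𝔬.G0 U ∘ₗ Dds μ))
      (fun a a' => BiD * Real.exp (-(δ₀ * (geo9K i).dist a a')))) :
    HasMaj (bHZ (κ := κ) i (R := R₀) (H := H₀) hε0 hε1 hεp) (cNormR R₀ H₀ 𝔬.blkW hG.lenle 0) (𝔬.Dvstar U ∘ₗ (𝔬.G0 U ∘ₗ 𝔬.Dv U))
      (fun a a' => BdD * Real.exp (-(δ₃ * (geo9K i).dist a a'))) := by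
  have hU : ∀ (ν : Fin (d + 1)) (s : Site (PV d ℓ i.m i.K hd hL) 0), ‖(rd U ν s : Matrix (Fin N) (Fin N) ℂ)‖ ≤ 1 ∧
      ‖(((rd U ν s)⁻¹ : (Matrix (Fin N) (Fin N) ℂ)ˣ) : Matrix (Fin N) (Fin N) ℂ)‖ ≤ 1 := fun ν s => specialUnitaryUnits_le_U1 (hUG ν s)
  have hDv' : 𝔬.Dv U = ∑ μ, Dds μ ∘ₗ JcoKH i b B rd μ U := by rw [hDv, hDds]; exact DvcoKH_eq_sum i b B rd U
  have hJ : ∀ μ, HasMaj (bHZ (κ := κ) i (R := R₀) (H := H₀) hε0 hε1 hεp) (bHZK (κ := κ) i (R := R₀) (H := H₀) hε0 hε1 hεp) (JcoKH i b B rd μ U)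
      (fun a a' => CJS (d := d) (ℓ := ℓ) b p ϑ δJ * Real.exp (-(δJ * (geo9K i).dist a a'))) := fun μ =>
    hasMaj_JcoKH_smooth i b B rd hε0 hε1 hεp hβ1 hbI0 hU hϑ hΘ (fun _ _ h => dist_sIK_le_of_nearY i hβ1 h) hδJ μ
  have hBdD' : (Fintype.card (Fin (d + 1)) : ℝ) * ((bHZK (κ := κ) i (R := R₀) (H := H₀) hε0 hε1 hεp).κ * BiD * CJS (d := d) (ℓ := ℓ) b p ϑ δJ * c) ≤ BdD := by
    rw [Fintype.card_fin, Nat.cast_add, Nat.cast_one]; exact hBdD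
  exact h44DsDv_of_h44Ds hG hrow hBiD (CJS_nonneg (d := d) (ℓ := ℓ) b hϑ δJ) hδ₃ hδ₃0 hδ₃J hBdD' hDv' h44Ds hJ

variable {dF : ℕ} {δF α L₀ : ℝ} {p : ℝ} (h1p : (1 : ℝ) ≤ p)

/-- ★★ **`Letters313DMZ.dgDHd ν` AT THE SMOOTH PIN `bH13 := weightNorm (bHZ 1 p) (Lʲη)⁻¹`** — ∇_{U,ν}G₀D_U : bH13 → 𝔠⁽¹⁾ from the displayed (3.44) members `h44m μ` at the input class
`bHZK 1 p` and the length-weighted smooth J-letter; `B₃ ≥ (d+1)·(1 + C_Lip)·B_i·L₀·(CJS·L)·c`, `0 ≤ δ₃ ≤ δ₀ − αδ_F`, `δ₃ + σ ≤ δ_J − αδ_F`.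
[cite: Balaban1985BackgroundPropagators, Thm 3.3 (3.44) p.398 + (3.152)–(3.153) p.426 + (3.3) p.390 + (3.35) p.396; Balaban1984PropagatorsII, (2.26) p.228 + (2.52)–(2.56) pp.232–233 + Lemma 2.1 (2.60)–(2.61) p.234] -/
theorem dgDHd_pins_smooth {R₀ : ℝ} {H₀ : Prop}
    (hβ1 : ∀ f : FBondY i, (geomT i.D).dist (β i.hN i.D i.hk (bI f)) (blkV1 i.hN i.D f) ≤ 1)
    (hbI0 : ∀ f : FBondY i, bI f = bI ⟨f.src, 0⟩) {U : B.Cfg}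
    (hUG : ∀ (ν : Fin (d + 1)) (s : Site (PV d ℓ i.m i.K hd hL) 0), rd U ν s ∈ specialUnitaryUnits (Fin N)) {ϑ : ℝ} (hϑ : 0 ≤ ϑ)
    (hΘ : ∀ (μ : Fin (d + 1)) (s s' : Site (PV d ℓ i.m i.K hd hL) 0), Adm i ⟨s, μ⟩ ⟨s', μ⟩ →
      tpar i ⟨s, μ⟩ ⟨s', μ⟩ ^ (-(1 : ℝ)) * ‖(rd U μ s : Matrix (Fin N) (Fin N) ℂ) - (rd U μ s' : Matrix (Fin N) (Fin N) ℂ)‖ ≤ ϑ)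
    (hG : GeoOK (geo9K i)) {σ c : ℝ} (hrow : RowSum (toB6 (geo9K i) R₀ H₀) σ c) (hF : Facts347 (geo9K i) R₀ H₀ dF δF α L₀)
    {Y : Type} [Fintype Y] {W : Type} [Fintype W] (𝔬 : Ops (geo9K i) B (XBK κ i) Y W (XSK κ i))
    (hDv : 𝔬.Dv U = DvcoKH i b B rd U)
    {Dds : Fin (d + 1) → Module.End ℝ (XBK κ i → ℝ)} (hDds : Dds = fun μ => coordOpK b (fun _ : Fin (d + 1) => cdsBₗ i (rd U) μ))
    {Ddν : Module.End ℝ (XBK κ i → ℝ)} {Bi δ₀ δJ B₃ δ₃ : ℝ} (hBi : 0 ≤ Bi) (hc : 0 ≤ c) (hδJ : 0 ≤ δJ)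
    (hδ₃ : 0 ≤ δ₃) (hδ₃0 : δ₃ ≤ δ₀ - α * δF) (hδ₃J : δ₃ + σ ≤ (δJ - α * δF))
    (hB₃ : ((d : ℝ) + 1) * ((1 + CLip d ℓ) * (Bi * L₀) * (CJS (d := d) (ℓ := ℓ) b p ϑ δJ * (geo9K i).L) * c) ≤ B₃)
    (h44m : ∀ μ, HasMaj (bHZK (κ := κ) i (R := R₀) (H := H₀) zero_le_one le_rfl h1p) (BlockNorm.ofBlocks (toB6 (geo9K i) R₀ H₀) 𝔬.blk)
      (Ddν ∘ₗ (𝔬.G0 U ∘ₗ Dds μ)) (fun a a' => Bi * Real.exp (-(δ₀ * (geo9K i).dist a a')))) :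
    HasMaj (weightNorm (bHZ (κ := κ) i (R := R₀) (H := H₀) zero_le_one le_rfl h1p) (fun y => ((geo9K i).len y)⁻¹) fun y => inv_nonneg.mpr (hG.lenle y))
      (cNorm R₀ H₀ 𝔬.blk hG.lenle 1) (Ddν ∘ₗ 𝔬.G0 U ∘ₗ 𝔬.Dv U) (fun a a' => B₃ * Real.exp (-(δ₃ * (geo9K i).dist a a'))) := by
  have hU : ∀ (ν : Fin (d + 1)) (s : Site (PV d ℓ i.m i.K hd hL) 0), ‖(rd U ν s : Matrix (Fin N) (Fin N) ℂ)‖ ≤ 1 ∧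
      ‖(((rd U ν s)⁻¹ : (Matrix (Fin N) (Fin N) ℂ)ˣ) : Matrix (Fin N) (Fin N) ℂ)‖ ≤ 1 := fun ν s => specialUnitaryUnits_le_U1 (hUG ν s)
  have hDv' : 𝔬.Dv U = ∑ μ, Dds μ ∘ₗ JcoKH i b B rd μ U := by rw [hDv, hDds]; exact DvcoKH_eq_sum i b B rd U
  have hJ := fun μ => hasMaj_JcoKH_smooth_len i b B rd hG hF zero_le_one le_rfl h1p hβ1 hbI0 hU hϑ hΘ hδJ μ
  have hB₃' : (Fintype.card (Fin (d + 1)) : ℝ) * ((1 + CLip d ℓ) * (Bi * L₀) * (CJS (d := d) (ℓ := ℓ) b p ϑ δJ * (geo9K i).L) * c) ≤ B₃ := by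
    rw [Fintype.card_fin, Nat.cast_add, Nat.cast_one]; exact hB₃
  have hCJ : 0 ≤ CJS (d := d) (ℓ := ℓ) b p ϑ δJ * (geo9K i).L := mul_nonneg (CJS_nonneg (d := d) (ℓ := ℓ) b hϑ δJ) (le_trans zero_le_one hF.one_le_L)
  exact dgDHd_of_h44m hG hrow hF hBi hCJ hc (le_of_eq rfl) hδ₃ hδ₃0 hδ₃J hB₃' hDv' h44m hJ

/-- ★★ **`Letters313DZ.dgDH` AT THE SMOOTH PIN `bH13 := weightNorm (bHZ 1 p) (Lʲη)⁻¹`** — ∇_UG₀D_U : bH13 → 𝔠_Y⁽¹⁾ with the slice-diagonal `∇_U` (`hD`: `DcoK = Σ_ν Π_ν ∘ ∇_{U,ν}`, the Π-letter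
`hasMaj_sliceProjK_cNorm`), from the displayed `h44m ν μ` at `bHZK 1 p` and the length-weighted smooth J-letter; `B₃` per ν as in `dgDHd_pins_smooth`, then `B₃p ≥ (d+1)·B₃·c`.
[cite: Balaban1985BackgroundPropagators, Thm 3.13 p.426 + Thm 3.3 (3.44) p.398 + (3.42) p.397 («∇_UG(U)») + (3.152)–(3.153) p.426 + (3.3) p.390; Balaban1984PropagatorsII, (2.26) p.228 + (2.52)–(2.56) pp.232–233 + Lemma 2.1 (2.60)–(2.61) p.234] -/
theorem dgDH_pins_smooth {R₀ : ℝ} {H₀ : Prop}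
    (hβ1 : ∀ f : FBondY i, (geomT i.D).dist (β i.hN i.D i.hk (bI f)) (blkV1 i.hN i.D f) ≤ 1)
    (hbI0 : ∀ f : FBondY i, bI f = bI ⟨f.src, 0⟩) {U : B.Cfg}
    (hUG : ∀ (ν : Fin (d + 1)) (s : Site (PV d ℓ i.m i.K hd hL) 0), rd U ν s ∈ specialUnitaryUnits (Fin N)) {ϑ : ℝ} (hϑ : 0 ≤ ϑ)
    (hΘ : ∀ (μ : Fin (d + 1)) (s s' : Site (PV d ℓ i.m i.K hd hL) 0), Adm i ⟨s, μ⟩ ⟨s', μ⟩ →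
      tpar i ⟨s, μ⟩ ⟨s', μ⟩ ^ (-(1 : ℝ)) * ‖(rd U μ s : Matrix (Fin N) (Fin N) ℂ) - (rd U μ s' : Matrix (Fin N) (Fin N) ℂ)‖ ≤ ϑ)
    (hG : GeoOK (geo9K i)) {σ c : ℝ} (hrow : RowSum (toB6 (geo9K i) R₀ H₀) σ c) (hF : Facts347 (geo9K i) R₀ H₀ dF δF α L₀)
    {W : Type} [Fintype W] (𝔬 : Ops (geo9K i) B (XBK κ i) (XBK κ i) W (XSK κ i))
    (hblk : 𝔬.blk = blkBK i bI) (hblkY : 𝔬.blkY = blkBK i bI)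
    (hDv : 𝔬.Dv U = DvcoKH i b B rd U) (hD : 𝔬.D U = B9CoReadingCoords.DcoK i b B rd U)
    {Dd Dds : Fin (d + 1) → Module.End ℝ (XBK κ i → ℝ)}
    (hDd : Dd = fun ν => coordOpK b (fun _ : Fin (d + 1) => cdBₗ i (rd U) ν))
    (hDds : Dds = fun μ => coordOpK b (fun _ : Fin (d + 1) => cdsBₗ i (rd U) μ))
    {Bi δ₀ δJ B₃ δ₃ B₃p : ℝ} (hBi : 0 ≤ Bi) (hc : 0 ≤ c) (hδJ : 0 ≤ δJ)
    (hδ₃ : 0 ≤ δ₃) (hδ₃0 : δ₃ ≤ δ₀ - α * δF) (hδ₃J : δ₃ + σ ≤ (δJ - α * δF))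
    (hB₃ : ((d : ℝ) + 1) * ((1 + CLip d ℓ) * (Bi * L₀) * (CJS (d := d) (ℓ := ℓ) b p ϑ δJ * (geo9K i).L) * c) ≤ B₃)
    (hB₃p : ((d : ℝ) + 1) * (1 * B₃ * c) ≤ B₃p)
    (h44m : ∀ ν μ, HasMaj (bHZK (κ := κ) i (R := R₀) (H := H₀) zero_le_one le_rfl h1p) (BlockNorm.ofBlocks (toB6 (geo9K i) R₀ H₀) 𝔬.blk)
      (Dd ν ∘ₗ (𝔬.G0 U ∘ₗ Dds μ)) (fun a a' => Bi * Real.exp (-(δ₀ * (geo9K i).dist a a')))) :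
    HasMaj (weightNorm (bHZ (κ := κ) i (R := R₀) (H := H₀) zero_le_one le_rfl h1p) (fun y => ((geo9K i).len y)⁻¹) fun y => inv_nonneg.mpr (hG.lenle y))
      (cNorm R₀ H₀ 𝔬.blkY hG.lenle 1) (𝔬.D U ∘ₗ 𝔬.G0 U ∘ₗ 𝔬.Dv U) (fun a a' => B₃p * Real.exp (-(δ₃ * (geo9K i).dist a a'))) := by
  have hU : ∀ (ν : Fin (d + 1)) (s : Site (PV d ℓ i.m i.K hd hL) 0), ‖(rd U ν s : Matrix (Fin N) (Fin N) ℂ)‖ ≤ 1 ∧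
      ‖(((rd U ν s)⁻¹ : (Matrix (Fin N) (Fin N) ℂ)ˣ) : Matrix (Fin N) (Fin N) ℂ)‖ ≤ 1 := fun ν s => specialUnitaryUnits_le_U1 (hUG ν s)
  have hDv' : 𝔬.Dv U = ∑ μ, Dds μ ∘ₗ JcoKH i b B rd μ U := by rw [hDv, hDds]; exact DvcoKH_eq_sum i b B rd U
  have hD' : 𝔬.D U = ∑ ν, sliceProjK ν ∘ₗ Dd ν := by rw [hD, hDd]; exact DcoK_eq_sum i b B rd U
  have hJ := fun μ => hasMaj_JcoKH_smooth_len i b B rd hG hF zero_le_one le_rfl h1p hβ1 hbI0 hU hϑ hΘ hδJ μ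
  have hPr : ∀ ν, HasMaj (cNorm R₀ H₀ 𝔬.blk hG.lenle 1) (cNorm R₀ H₀ 𝔬.blkY hG.lenle 1) (sliceProjK (κ := κ) ν)
      (fun a a' => (1 : ℝ) * Real.exp (-((δ₃ + σ) * (geo9K i).dist a a'))) := fun ν => by
    rw [hblk, hblkY]; exact hasMaj_sliceProjK_cNorm i (blkBK i bI) hG.lenle 1 ν
  have hB₃a : (Fintype.card (Fin (d + 1)) : ℝ) * ((1 + CLip d ℓ) * (Bi * L₀) * (CJS (d := d) (ℓ := ℓ) b p ϑ δJ * (geo9K i).L) * c) ≤ B₃ := by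
    rw [Fintype.card_fin, Nat.cast_add, Nat.cast_one]; exact hB₃
  have hB₃b : (Fintype.card (Fin (d + 1)) : ℝ) * (1 * B₃ * c) ≤ B₃p := by
    rw [Fintype.card_fin, Nat.cast_add, Nat.cast_one]; exact hB₃p
  have hCJ : 0 ≤ CJS (d := d) (ℓ := ℓ) b p ϑ δJ * (geo9K i).L := mul_nonneg (CJS_nonneg (d := d) (ℓ := ℓ) b hϑ δJ) (le_trans zero_le_one hF.one_le_L)
  exact dgDH_of_h44m hG hrow hF hBi hCJ zero_le_one hc (le_of_eq rfl) hδ₃ hδ₃0 hδ₃J hB₃a hδ₃ le_rfl le_rfl hB₃b hDv' hD' h44m hJ hPr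

/-- ★★ **`Letters313HZ.pYDH β` AT THE SMOOTH PIN `bH13 := weightNorm (bHZ 1 p) (Lʲη)⁻¹`** — Φ^Y_β∘∇_U∘G₀∘D_U : bH13 → 𝔠_{P_Y}^{(β−1)} from the displayed directional Φ^Y-(3.45) members `h45Y μ`
at the input class `bHZK 1 p` and the length-weighted smooth J-letter; `BhD ≥ (d+1)·(1 + C_Lip)·B_i·L₀·(CJS·L)·c`, `δ₃ ≤ δ₀ − αδ_F`, `δ₃ + σ ≤ δ_J − αδ_F`.
[cite: Balaban1985BackgroundPropagators, Thm 3.13 p.426 + (3.45) p.398 + (3.152)–(3.153) p.426 + (3.3) p.390 + (3.35) p.396; Balaban1984PropagatorsII, (2.26) p.228 + (2.52)–(2.56) pp.232–233 + Lemma 2.1 (2.60)–(2.61) p.234] -/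
theorem pYDH_pins_smooth {R₀ : ℝ} {H₀ : Prop}
    (hβ1 : ∀ f : FBondY i, (geomT i.D).dist (β i.hN i.D i.hk (bI f)) (blkV1 i.hN i.D f) ≤ 1)
    (hbI0 : ∀ f : FBondY i, bI f = bI ⟨f.src, 0⟩) {U : B.Cfg}
    (hUG : ∀ (ν : Fin (d + 1)) (s : Site (PV d ℓ i.m i.K hd hL) 0), rd U ν s ∈ specialUnitaryUnits (Fin N)) {ϑ : ℝ} (hϑ : 0 ≤ ϑ)
    (hΘ : ∀ (μ : Fin (d + 1)) (s s' : Site (PV d ℓ i.m i.K hd hL) 0), Adm i ⟨s, μ⟩ ⟨s', μ⟩ →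
      tpar i ⟨s, μ⟩ ⟨s', μ⟩ ^ (-(1 : ℝ)) * ‖(rd U μ s : Matrix (Fin N) (Fin N) ℂ) - (rd U μ s' : Matrix (Fin N) (Fin N) ℂ)‖ ≤ ϑ)
    (hG : GeoOK (geo9K i)) {σ c : ℝ} (hrow : RowSum (toB6 (geo9K i) R₀ H₀) σ c) (hF : Facts347 (geo9K i) R₀ H₀ dF δF α L₀)
    {Y : Type} [Fintype Y] {W : Type} [Fintype W] {PX PY : Type} [Fintype PX] [Fintype PY]
    (𝔬 : Ops (geo9K i) B (XBK κ i) Y W (XSK κ i)) (𝔭 : HolderProbes (geo9K i) B (XBK κ i) Y PX PY)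
    (hDv : 𝔬.Dv U = DvcoKH i b B rd U)
    {Dds : Fin (d + 1) → Module.End ℝ (XBK κ i → ℝ)} (hDds : Dds = fun μ => coordOpK b (fun _ : Fin (d + 1) => cdsBₗ i (rd U) μ))
    {βH Bi δ₀ δJ BhD δ₃ : ℝ} (hBi : 0 ≤ Bi) (hc : 0 ≤ c) (hδJ : 0 ≤ δJ)
    (hδ₃ : 0 ≤ δ₃) (hδ₃0 : δ₃ ≤ δ₀ - α * δF) (hδ₃J : δ₃ + σ ≤ (δJ - α * δF))
    (hBhD : ((d : ℝ) + 1) * ((1 + CLip d ℓ) * (Bi * L₀) * (CJS (d := d) (ℓ := ℓ) b p ϑ δJ * (geo9K i).L) * c) ≤ BhD)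
    (h45Y : ∀ μ, HasMaj (bHZK (κ := κ) i (R := R₀) (H := H₀) zero_le_one le_rfl h1p) (BlockNorm.ofBlocks (toB6 (geo9K i) R₀ H₀) 𝔭.blkPY)
      (𝔭.ΦY U βH ∘ₗ (𝔬.D U ∘ₗ (𝔬.G0 U ∘ₗ Dds μ))) (fun a a' => Bi * (geo9K i).len a ^ (-βH) * Real.exp (-(δ₀ * (geo9K i).dist a a')))) :
    HasMaj (weightNorm (bHZ (κ := κ) i (R := R₀) (H := H₀) zero_le_one le_rfl h1p) (fun y => ((geo9K i).len y)⁻¹) fun y => inv_nonneg.mpr (hG.lenle y))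
      (cNormR R₀ H₀ 𝔭.blkPY hG.lenle (βH - 1)) ((𝔭.ΦY U βH ∘ₗ 𝔬.D U ∘ₗ 𝔬.G0 U) ∘ₗ 𝔬.Dv U)
      (fun a a' => BhD * Real.exp (-(δ₃ * (geo9K i).dist a a'))) := by
  have hU : ∀ (ν : Fin (d + 1)) (s : Site (PV d ℓ i.m i.K hd hL) 0), ‖(rd U ν s : Matrix (Fin N) (Fin N) ℂ)‖ ≤ 1 ∧
      ‖(((rd U ν s)⁻¹ : (Matrix (Fin N) (Fin N) ℂ)ˣ) : Matrix (Fin N) (Fin N) ℂ)‖ ≤ 1 := fun ν s => specialUnitaryUnits_le_U1 (hUG ν s)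
  have hDv' : 𝔬.Dv U = ∑ μ, Dds μ ∘ₗ JcoKH i b B rd μ U := by rw [hDv, hDds]; exact DvcoKH_eq_sum i b B rd U
  have hJ := fun μ => hasMaj_JcoKH_smooth_len i b B rd hG hF zero_le_one le_rfl h1p hβ1 hbI0 hU hϑ hΘ hδJ μ
  have hBhD' : (Fintype.card (Fin (d + 1)) : ℝ) * ((1 + CLip d ℓ) * (Bi * L₀) * (CJS (d := d) (ℓ := ℓ) b p ϑ δJ * (geo9K i).L) * c) ≤ BhD := by
    rw [Fintype.card_fin, Nat.cast_add, Nat.cast_one]; exact hBhD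
  have hCJ : 0 ≤ CJS (d := d) (ℓ := ℓ) b p ϑ δJ * (geo9K i).L := mul_nonneg (CJS_nonneg (d := d) (ℓ := ℓ) b hϑ δJ) (le_trans zero_le_one hF.one_le_L)
  exact pYDH_of_h45Y hG hrow hF hBi hCJ hc (le_of_eq rfl) hδ₃ hδ₃0 hδ₃J hBhD' hDv' h45Y hJ

end Members

end Literature.MathematicalPhysics.QuantumFieldTheory.Balaban1983to89.B9Thm313WholeDvHolderAtPinsSmooth
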